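import Summits.QuantumFields.YangMills.Theorems.BalabanLadderIRcofSchurFejerSplitVanishing
import Summits.QuantumFields.YangMills.Theorems.BalabanLadderIRcofSchurFejerJointAmp
import Summits.QuantumFields.YangMills.Theorems.BalabanLadderIRcofSchurFejerGenerationPi
import Mathlib.GroupTheory.FiniteAbelian.Basic
import HarnessLib

/-!
# Schur–Fejér splitting §8e–f: product Fejér windows and split windows for EVERY finite central kernel — stub S2ᵛ `SplitVanishing` text proved

(8e) PRODUCT WINDOWS `prodWindowOf φ n h = Π_i windowOf (φ i) (n i) h` with the eight `IsSplitWindow` clauses (positive type by iterated Schur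
products `Matrix.PosSemidef.hadamard`; EXACTNESS `prodWindowOf_exact : Σᶠ_{k ∈ Γ} W(k h) = 1` whenever `φ_i(γ h) = ω_i^{c_i(γ)} φ_i(h)`: the box
parametrises `Γ` through `elemOf`, Fubini `Finset.prod_univ_sum`, the scalar Fejér identity `fejerSum_exact` per coordinate);
`isSplitWindow_prodWindowOf`.  (8f) ASSEMBLY: `exists_isSplitWindow_of_basis` (labels = non-empty joint amplitudes; exponents from
`exists_exponents_pi` hitting each basis character; `φ_i := Π_l (ampChar ρH P_l)^{f_i l}` via `IsTwistChar.prod`), `exists_isSplitWindow_of_finite_central`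
(`Γ` finite central ⇒ commutative ⇒ `CommGroup.equiv_prod_multiplicative_zmod_of_finite`), ★ `splitVanishingAt_of_finite_central_ker`
(+ the landed `splitVanishingAt_of_window`) and ★ `splitVanishing_text` = the statement of stub S2ᵛ `EquipartitionSeam.SplitVanishing`
(`Cruxes/IRcof/Lines/equipartition_seam.lean` l.255) VERBATIM — in a file that also sees the skeleton,
`theorem … : EquipartitionSeam.SplitVanishing := SchurFejer.splitVanishing_text` closes the stub.

HONEST LABEL.  The Yang–Mills mass gap (Clay) is NOT proved; `IRcof` ∕ `IR` are 0 ∕ 1 proved; this is finite-dimensional representation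
theory toward ONE stub (S2ᵛ `EquipartitionSeam.SplitVanishing`) of census row 47 (mechanism 0, transported; class PWP); nothing continuum ∕ OS ∕ Clay.
Source: ideator `ym-ir-idea-22` g4, Lines core `Cruxes/IRcof/Lines/equipartition_seam_SchurFejerCore.lean` rev 11 (crux write 80e9377d57ba), verbatim.

LANDING NOTE (custody LEAD ym-ir-line-ab-p1 g7): gate-forced only — one-line docstrings added where the lint requires them.
-/

set_option autoImplicit false

noncomputable section

open Finset Complex

namespace Summit.QuantumFields.YangMills.Cruxes.IRcof.EquipartitionSeam.SchurFejer

open scoped ComplexOrder Matrix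

section ProdWindow

variable {H : Type} [Group H] [TopologicalSpace H]

/-- The PRODUCT WINDOW `Π_i windowOf φ_i N_i`. -/
def prodWindowOf {ι : Type} [Fintype ι] (φ : ι → H → ℂ) (N : ι → ℕ) (h : H) : ℝ :=
  ∏ i, windowOf (φ i) (N i) h

variable {ι : Type} [Fintype ι]

omit [Group H] in
/-- `continuous_prodWindowOf` (see the module docstring; verbatim from the Lines core §8). -/
theorem continuous_prodWindowOf {φ : ι → H → ℂ} (hφ : ∀ i, Continuous (φ i)) (N : ι → ℕ) :
    Continuous (prodWindowOf φ N) := by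
  unfold prodWindowOf
  exact continuous_finsetProd _ fun i _ => continuous_windowOf (hφ i) (N i)

omit [Group H] [TopologicalSpace H] in
/-- `prodWindowOf_nonneg` (see the module docstring; verbatim from the Lines core §8). -/
theorem prodWindowOf_nonneg {φ : ι → H → ℂ} (hφ : ∀ i h, ‖φ i h‖ ≤ 1) (N : ι → ℕ) (h : H) :
    0 ≤ prodWindowOf φ N h :=
  Finset.prod_nonneg fun i _ => windowOf_nonneg (hφ i) (N i) h

omit [Group H] [TopologicalSpace H] in
/-- `prodWindowOf_le_one` (see the module docstring; verbatim from the Lines core §8). -/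
theorem prodWindowOf_le_one {φ : ι → H → ℂ} (hφ : ∀ i h, ‖φ i h‖ ≤ 1) (N : ι → ℕ) (h : H) :
    prodWindowOf φ N h ≤ 1 :=
  Finset.prod_le_one (fun i _ => windowOf_nonneg (hφ i) (N i) h) fun i _ => windowOf_le_one (hφ i) (N i) h

omit [TopologicalSpace H] in
/-- `prodWindowOf_inv` (see the module docstring; verbatim from the Lines core §8). -/
theorem prodWindowOf_inv {φ : ι → H → ℂ} (hφ : ∀ i h, φ i h⁻¹ = starRingEnd ℂ (φ i h)) (N : ι → ℕ)
    (h : H) : prodWindowOf φ N h⁻¹ = prodWindowOf φ N h :=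
  Finset.prod_congr rfl fun i _ => windowOf_inv (hφ i) (N i) h

omit [TopologicalSpace H] in
/-- `prodWindowOf_conj` (see the module docstring; verbatim from the Lines core §8). -/
theorem prodWindowOf_conj {φ : ι → H → ℂ} (hφ : ∀ i g h, φ i (g * h * g⁻¹) = φ i h) (N : ι → ℕ)
    (g h : H) : prodWindowOf φ N (g * h * g⁻¹) = prodWindowOf φ N h :=
  Finset.prod_congr rfl fun i _ => windowOf_conj (hφ i) (N i) g h

omit [TopologicalSpace H] in
/-- `prodWindowOf_one` (see the module docstring; verbatim from the Lines core §8). -/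
theorem prodWindowOf_one {φ : ι → H → ℂ} (hφ : ∀ i, φ i 1 = 1) {N : ι → ℕ} (hN : ∀ i, 0 < N i) :
    prodWindowOf φ N 1 = 1 :=
  Finset.prod_eq_one fun i _ => windowOf_one (hφ i) (hN i)

omit [TopologicalSpace H] in
/-- Gram matrices of the product window are PSD (iterated Schur products). -/
theorem posSemidef_prodWindowOf_gram {φ : ι → H → ℂ}
    (hg : ∀ i (n : ℕ) (x : Fin n → H), (Matrix.of fun a b : Fin n => φ i ((x a)⁻¹ * x b)).PosSemidef)
    (N : ι → ℕ) {n : ℕ} (x : Fin n → H) :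
    (Matrix.of fun a b : Fin n => ((prodWindowOf φ N ((x a)⁻¹ * x b) : ℝ) : ℂ)).PosSemidef := by
  classical
  unfold prodWindowOf
  suffices hs : ∀ s : Finset ι, (Matrix.of fun a b : Fin n =>
      ((∏ i ∈ s, windowOf (φ i) (N i) ((x a)⁻¹ * x b) : ℝ) : ℂ)).PosSemidef from hs Finset.univ
  intro s
  induction s using Finset.induction_on with
  | empty =>
      have h : (Matrix.of fun a b : Fin n =>
          ((∏ i ∈ (∅ : Finset ι), windowOf (φ i) (N i) ((x a)⁻¹ * x b) : ℝ) : ℂ)) =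
          Matrix.vecMulVec (star (fun _ : Fin n => (1 : ℂ))) (fun _ => (1 : ℂ)) := by
        ext a b
        simp [Matrix.vecMulVec_apply]
      rw [h]
      exact Matrix.posSemidef_vecMulVec_star_self _
  | insert i s hi ih =>
      have heq : (Matrix.of fun a b : Fin n =>
          ((∏ i' ∈ insert i s, windowOf (φ i') (N i') ((x a)⁻¹ * x b) : ℝ) : ℂ)) =
          (Matrix.of fun a b : Fin n => ((windowOf (φ i) (N i) ((x a)⁻¹ * x b) : ℝ) : ℂ)) ⊙
            (Matrix.of fun a b : Fin n =>
              ((∏ i' ∈ s, windowOf (φ i') (N i') ((x a)⁻¹ * x b) : ℝ) : ℂ)) := by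
        ext a b
        simp only [Matrix.of_apply, Matrix.hadamard_apply, Finset.prod_insert hi, Complex.ofReal_mul]
      rw [heq]
      exact (posSemidef_windowOf_gram (hg i) (N i) x).hadamard ih

omit [TopologicalSpace H] in
/-- `prodWindowOf_posType` (see the module docstring; verbatim from the Lines core §8). -/
theorem prodWindowOf_posType {φ : ι → H → ℂ}
    (hg : ∀ i (n : ℕ) (x : Fin n → H), (Matrix.of fun a b : Fin n => φ i ((x a)⁻¹ * x b)).PosSemidef)
    (N : ι → ℕ) (n : ℕ) (x : Fin n → H) (v : Fin n → ℂ) :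
    0 ≤ (∑ i, ∑ j, (starRingEnd ℂ) (v i) * v j *
      ((prodWindowOf φ N ((x i)⁻¹ * x j) : ℝ) : ℂ)).re := by
  have hq := (posSemidef_prodWindowOf_gram hg N x).dotProduct_mulVec_nonneg v
  have hexp : (∑ i, ∑ j, (starRingEnd ℂ) (v i) * v j *
      ((prodWindowOf φ N ((x i)⁻¹ * x j) : ℝ) : ℂ)) =
      dotProduct (star v)
        (Matrix.mulVec (Matrix.of fun i j : Fin n =>
          ((prodWindowOf φ N ((x i)⁻¹ * x j) : ℝ) : ℂ)) v) := by
    simp only [dotProduct, Matrix.mulVec, Matrix.of_apply, Pi.star_apply, Complex.star_def,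
      Finset.mul_sum]
    refine Finset.sum_congr rfl fun i _ => Finset.sum_congr rfl fun j _ => ?_
    ring
  rw [hexp]
  exact (Complex.nonneg_iff.1 hq).1

omit [TopologicalSpace H] in
/-- EXACTNESS of the product window over `Γ`: Fubini over the box `Π_i [0, n_i) ≃ Γ` and the scalar Fejér identity per coordinate. -/
theorem prodWindowOf_exact {Γ : Subgroup H} [DecidableEq ι] {n : ι → ℕ}
    (e : Γ ≃* ((i : ι) → Multiplicative (ZMod (n i)))) (hn : ∀ i, 0 < n i) {ω : ι → ℂ}
    (hω : ∀ i, IsPrimitiveRoot (ω i) (n i)) {φ : ι → H → ℂ}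
    (hφ : ∀ (i : ι) (γ : Γ) (h : H), φ i ((γ : H) * h) = ω i ^ coord e i γ * φ i h) (h : H) :
    ∑ᶠ k ∈ (Γ : Set H), prodWindowOf φ n (k * h) = 1 := by
  classical
  set box : Finset (ι → ℕ) := Fintype.piFinset (fun i => range (n i)) with hboxdef
  have hbox : ∀ a ∈ box, ∀ i, a i < n i := fun a ha i =>
    Finset.mem_range.1 (Fintype.mem_piFinset.1 ha i)
  have hset : (Γ : Set H) = ↑(box.image fun a : ι → ℕ => ((elemOf e a : Γ) : H)) := by
    ext y
    rw [Finset.coe_image]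
    constructor
    · intro hy
      refine ⟨fun i => coord e i ⟨y, hy⟩, ?_, ?_⟩
      · rw [Finset.mem_coe, Fintype.mem_piFinset]
        exact fun i => Finset.mem_range.2 (coord_lt e hn i _)
      · show ((elemOf e fun i => coord e i ⟨y, hy⟩ : Γ) : H) = y
        rw [elemOf_coord e hn]
    · rintro ⟨a, -, rfl⟩
      exact (elemOf e a).2
  have hinj : Set.InjOn (fun a : ι → ℕ => ((elemOf e a : Γ) : H)) ↑box := by
    intro a ha a' ha' hEq
    have hE : elemOf e a = elemOf e a' := Subtype.ext hEq
    funext i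
    have h1 := congrArg (coord e i) hE
    rwa [coord_elemOf e a (hbox a ha) i, coord_elemOf e a' (hbox a' ha') i] at h1
  rw [hset, finsum_mem_coe_finset, Finset.sum_image hinj]
  have hterm : ∀ a ∈ box, prodWindowOf φ n (((elemOf e a : Γ) : H) * h) =
      ∏ i, (fejerSum (ω i ^ a i * φ i h) (n i)).re / ((n i : ℝ) ^ 2) := by
    intro a ha
    unfold prodWindowOf windowOf
    refine Finset.prod_congr rfl fun i _ => ?_
    rw [hφ i, coord_elemOf e a (hbox a ha) i]
  rw [Finset.sum_congr rfl hterm, ← Finset.prod_univ_sum (fun i => range (n i))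
    (fun i j => (fejerSum (ω i ^ j * φ i h) (n i)).re / ((n i : ℝ) ^ 2))]
  refine Finset.prod_eq_one fun i _ => ?_
  rw [← Finset.sum_div, ← Complex.re_sum, fejerSum_exact (ω i) _ (n i) (hω i), natCast_sq_re]
  have : (0 : ℝ) < (n i : ℝ) := Nat.cast_pos.2 (hn i)
  exact div_self (by positivity)

/-- Twist characters `φ_i` with joint twists `ω_i^{c_i(γ)}` give a SPLIT WINDOW `Π_i windowOf φ_i n_i` for `Γ`. -/
theorem isSplitWindow_prodWindowOf {Γ : Subgroup H} [DecidableEq ι] {n : ι → ℕ}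
    (e : Γ ≃* ((i : ι) → Multiplicative (ZMod (n i)))) (hn : ∀ i, 0 < n i) {ω : ι → ℂ}
    (hω : ∀ i, IsPrimitiveRoot (ω i) (n i)) {φ : ι → H → ℂ}
    (hφ : ∀ (i : ι) (γ : Γ), IsTwistChar (γ : H) (ω i ^ coord e i γ) (φ i)) :
    IsSplitWindow Γ (prodWindowOf φ n) := by
  have h1 : ∀ i, IsTwistChar ((1 : Γ) : H) (ω i ^ coord e i 1) (φ i) := fun i => hφ i 1
  exact ⟨continuous_prodWindowOf (fun i => (h1 i).continuous) n,
    prodWindowOf_nonneg (fun i => (h1 i).norm_le_one) n,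
    prodWindowOf_le_one (fun i => (h1 i).norm_le_one) n, prodWindowOf_inv (fun i => (h1 i).inv) n,
    prodWindowOf_conj (fun i => (h1 i).conj) n, prodWindowOf_posType (fun i => (h1 i).gram) n,
    prodWindowOf_one (fun i => (h1 i).one) hn, prodWindowOf_exact e hn hω (fun i γ h => (hφ i γ).twist h)⟩

end ProdWindow

section General

open MeasureTheory Filter Topology
open Literature.MathematicalPhysics.QuantumFieldTheory Literature.MathematicalPhysics.QuantumLattice
open Summit.QuantumFields.YangMills.Theorems.NonSimplyConnectedLatticeGap

variable {G H : Type} [Group G] [TopologicalSpace G] [Group H] [TopologicalSpace H]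

/-- Split windows from a basis `e : Γ ≃* Π_i ℤ_{n_i}` of a finite central `Γ`, for every faithful `ρH`. -/
theorem exists_isSplitWindow_of_basis (ρH : LatticeRep H) {Γ : Subgroup H} [Fintype Γ]
    (hcen : Γ ≤ Subgroup.center H) {ι : Type} [Fintype ι] [DecidableEq ι] {n : ι → ℕ}
    (e : Γ ≃* ((i : ι) → Multiplicative (ZMod (n i)))) (hn : ∀ i, 0 < n i) :
    ∃ W : H → ℝ, IsSplitWindow Γ W := by
  classical
  set ω : ι → ℂ := fun i => Complex.exp (2 * Real.pi * Complex.I / (n i)) with hωdef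
  have hω : ∀ i, IsPrimitiveRoot (ω i) (n i) := fun i => Complex.isPrimitiveRoot_exp (n i) (hn i).ne'
  have hωN : ∀ i, ω i ^ n i = 1 := fun i => (hω i).pow_eq_one
  have hω0 : ∀ i, ω i ≠ 0 := fun i => (hω i).ne_zero (hn i).ne'
  -- the non-empty joint labels
  set L : Finset (ι → ℕ) :=
    (Fintype.piFinset (fun i => range (n i))).filter (fun l => jointAmp ρH Γ (twistOn e ω l) ≠ 0)
    with hLdef
  have hLbox : ∀ l ∈ L, ∀ i, l i < n i := fun l hl i =>
    Finset.mem_range.1 (Fintype.mem_piFinset.1 (Finset.mem_filter.1 hl).1 i)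
  have hLne : ∀ l ∈ L, jointAmp ρH Γ (twistOn e ω l) ≠ 0 := fun l hl => (Finset.mem_filter.1 hl).2
  have hgen : ∀ m : ι → ℕ, (∀ i, m i < n i) → (∃ i, m i ≠ 0) →
      ∃ l ∈ L, ∏ i, (ω i ^ l i) ^ m i ≠ 1 := by
    intro m hm hm0
    obtain ⟨l, hl, hA, hne⟩ := exists_twistOn_nondegenerate ρH e hn hω m hm hm0
    exact ⟨l, Finset.mem_filter.2 ⟨hl, hA⟩, hne⟩
  -- for each coordinate an exponent family hitting the basis character `e_i`
  have hexp : ∀ i, ∃ f : (ι → ℕ) → ℕ,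
      ∀ i', (∑ l ∈ L, l i' * f l) ≡ (if i' = i then 1 else 0) [MOD n i'] :=
    fun i => exists_exponents_pi hn hω L hLbox hgen (fun i' => if i' = i then 1 else 0)
  choose f hf using hexp
  -- the Schur monomials of the amplitude characters
  set φ : ι → H → ℂ := fun i => ∏ l ∈ L, (ampChar ρH (jointAmp ρH Γ (twistOn e ω l))) ^ f i l
    with hφdef
  have hφ : ∀ (i : ι) (γ : Γ), IsTwistChar (γ : H) (ω i ^ coord e i γ) (φ i) := by
    intro i γ
    have hfac : ∀ l ∈ L, IsTwistChar (γ : H) ((twistOn e ω l γ) ^ f i l)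
        ((ampChar ρH (jointAmp ρH Γ (twistOn e ω l))) ^ f i l) := fun l hl =>
      (isTwistChar_jointAmpChar ρH hcen (twistOn_mul e hn hωN l) (twistOn_ne_zero e hω0 l)
        (hLne l hl) γ).pow (f i l)
    have hprod := IsTwistChar.prod L hfac
    have hexp : ∏ l ∈ L, (twistOn e ω l γ) ^ f i l = ω i ^ coord e i γ := by
      unfold twistOn
      simp_rw [← Finset.prod_pow, ← pow_mul]
      rw [Finset.prod_comm]
      simp_rw [Finset.prod_pow_eq_pow_sum]
      have hM : ∀ i', (∑ l ∈ L, l i' * coord e i' γ * f i l) =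
          (∑ l ∈ L, l i' * f i l) * coord e i' γ := by
        intro i'
        rw [Finset.sum_mul]
        exact Finset.sum_congr rfl fun l _ => by ring
      simp_rw [hM, pow_mul]
      rw [Finset.prod_eq_single i]
      · rw [pow_eq_pow_of_modEq (hωN i) (hf i i), if_pos rfl, pow_one]
      · intro i' _ hi'
        rw [pow_eq_pow_of_modEq (hωN i') (hf i i'), if_neg hi', pow_zero, one_pow]
      · intro h
        exact absurd (Finset.mem_univ i) h
    rw [hexp] at hprod
    exact hprod
  exact ⟨_, isSplitWindow_prodWindowOf e hn hω hφ⟩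

open scoped IsMulCommutative in
/-- **Split windows exist for EVERY finite central `Γ` and every faithful unitary `ρH`.** -/
theorem exists_isSplitWindow_of_finite_central (ρH : LatticeRep H) (Γ : Subgroup H)
    (hfin : (Γ : Set H).Finite) (hcen : Γ ≤ Subgroup.center H) : ∃ W : H → ℝ, IsSplitWindow Γ W := by
  classical
  haveI : Finite Γ := hfin.to_subtype
  haveI : Fintype Γ := Fintype.ofFinite Γ
  haveI : IsMulCommutative Γ :=
    ⟨⟨fun a b => Subtype.ext (Subgroup.mem_center_iff.1 (hcen b.2) (a : H))⟩⟩
  obtain ⟨ι, hι, n, hn, ⟨e⟩⟩ := CommGroup.equiv_prod_multiplicative_zmod_of_finite Γ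
  exact exists_isSplitWindow_of_basis ρH hcen e (fun i => lt_trans zero_lt_one (hn i))

/-- **S2ᵛ `SplitVanishing` at EVERY cover datum with FINITE CENTRAL kernel** (no cyclicity, Lie, simplicity or scalar-on-kernel
hypothesis), for every faithful unitary `ρH` and every `r`. -/
theorem splitVanishingAt_of_finite_central_ker [IsTopologicalGroup H] [CompactSpace H] [MeasurableSpace H]
    [BorelSpace H] (π : H →* G) (hπ : Continuous π) (hfin : (π.ker : Set H).Finite)
    (hcen : π.ker ≤ Subgroup.center H) (ρH : LatticeRep H) (r : LatticeRep G) :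
    ∃ c : ℝ → ℝ, Tendsto (fun β => c β * β) atTop atTop ∧ ∃ β_s : ℝ, ∀ β : ℝ, β_s ≤ β →
      ∃ w : H → ℝ, TwistSplitWeight π ρH r (c β) β w := by
  obtain ⟨W, hW⟩ := exists_isSplitWindow_of_finite_central ρH π.ker hfin hcen
  exact splitVanishingAt_of_window π hπ hfin hW ρH r

/-- **THE TEXT OF STUB S2ᵛ `EquipartitionSeam.SplitVanishing`, verbatim** (its Lie ∕ simple-connectivity ∕ surjectivity ∕
non-triviality binders are not used): closes the stub by `exact splitVanishing_text` in any file that sees both. -/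
theorem splitVanishing_text :
    ∀ (G : Type) [Group G] [TopologicalSpace G] [IsTopologicalGroup G] [CompactSpace G] [MeasurableSpace G]
    [BorelSpace G], IsCompactSimpleLieGroup G → ∀ (H : Type) [Group H] [TopologicalSpace H] [IsTopologicalGroup H]
    [CompactSpace H] [MeasurableSpace H] [BorelSpace H], IsCompactSimpleLieGroup H → SimplyConnectedSpace H →
    ∀ (π : H →* G), Continuous π → Function.Surjective π → π.ker ≤ Subgroup.center H → (π.ker : Set H).Finite →
    π.ker ≠ ⊥ → ∀ (ρH : LatticeRep H) (r : LatticeRep G),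
      ∃ c : ℝ → ℝ, Tendsto (fun β => c β * β) atTop atTop ∧ ∃ β_s : ℝ, ∀ β : ℝ, β_s ≤ β →
        ∃ w : H → ℝ, TwistSplitWeight π ρH r (c β) β w := by
  intro G _ _ _ _ _ _ _ H _ _ _ _ _ _ _ _ π hπ _ hcen hfin _ ρH r
  exact splitVanishingAt_of_finite_central_ker π hπ hfin hcen ρH r

end General

end Summit.QuantumFields.YangMills.Cruxes.IRcof.EquipartitionSeam.SchurFejer
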